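import Summits.Ventures.LatticeQCDFlow.Scaling.SimulatedTemperingFiniteSampler

/-!
HONEST FRAMING: exact (Metropolis-corrected) sampling algorithms for lattice gauge theory; figures
of merit are autocorrelation/cost numbers at stated couplings and volumes; no continuum-physics
claim.

# SimulatedTemperingLifted — THE LIFTED (NON-REVERSIBLE) SIMULATED-TEMPERING SAMPLER WITH TRANSPORT MAPS IS EXACT:
# CARRYING A DIRECTION `σ ∈ {↑,↓}`, "MOVE ONE LEVEL IN DIRECTION `σ` THROUGH THE MAP BETWEEN THE TWO COUPLINGS WITH THE
# EXACT-WEIGHT METROPOLIS PROBABILITY, ELSE REVERSE `σ`" LEAVES `π(k,x,σ) = μ_k(x)/(2(K+1))` STATIONARY FOR EVERY FAMILY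
# OF BIJECTIONS AND EVERY `μ_k`-STATIONARY WITHIN-LEVEL UPDATE, IS NOT REVERSIBLE, AND RISES ONE LEVEL PER STEP — THE
# SCHEME THE "REVERSIBLE OR NOT" CEILINGS OF CHAPTER H ARE FOR (lean-2 GEN-20, ours)

Venture-side (OURS).  Cell `lqcd-flow` (pub-lqcd), unit `pub-lqcd-lean-2-g20`, 2026-08-25.  `LevelSchemeCutCeiling` (mixing
floors with `π` merely stationary), `LevelSchemeBallisticFloor` (order `K` for every scheme rising one level per step) and
`ExchangeSchemeCutMixingFloor` speak of moves that need NOT be reversible; this file puts the standard one into the tree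
as an EXACT sampler, with the venture's ingredient built in: the LIFTED Metropolis level move of simulated tempering
(lifting: Diaconis–Holmes–Neal 2000, Turitsyn–Chertkov–Vucelja 2011, the Literature's `SkewDetailedBalance`; tempering:
Sakai–Hukushima, irreversible simulated tempering, 2016) carrying the configuration through TRANSPORT MAPS between
adjacent couplings (`e k : S ≃ S` from level `k` up to `k+1`, its inverse downwards; `e = fun _ => Equiv.refl S` is
plain lifting), in the finite exact-weight setting of `SimulatedTemperingFiniteSampler`: state `Fin (K+1) × (S × Bool)`
(level, configuration, direction; `true` = up), target `π = stFinLaw (stLiftLaw μ)`, `stLiftLaw μ k (x,σ) = μ_k(x)/2`.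
THE MOVE `L = stLiftLevel μ e`: from `(k, x, σ)` let `k' = stLiftNext k σ` (`k±1` if it exists) and `φ = stLiftMap e k σ`;
with probability `a = min{1, μ_{k'}(φx)/μ_k(x)}` (`stLiftAcc`; `0` if there is no `k'`) go to `(k', φx, σ)`, otherwise to
`(k, x, ¬σ)`.  THE SAMPLER: `P = t·L + (1−t)·stFinWithin (stLiftWithin M)` (`stLiftWithin M k` moves `x` by `M_k`, keeps `σ`).

## What is proved

* §1 defs + `stLiftLaw_pos`, `sum_stLiftLaw`, `stLiftNext_spec`, `stLiftAcc_mem`,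
  **`stLiftLevel_isRowStochastic`**, `stLiftLevel_snd_eq` (the configuration is kept or transported — sector-preserving
  maps keep the sector), **`stLiftLevel_rise_le_one`** (the hypothesis of `LevelSchemeBallisticFloor`),
  `stLiftWithin_isRowStochastic`, `stLiftWithin_isStationary`.
* §2 **`stLiftLevel_isStationary`** — `π` IS STATIONARY FOR `L`, for EVERY family of bijections `e`: the advance flow
  into `(k,y,σ)` (from `(k∓1, φ⁻¹y, σ)`) equals the advance flow out of `(k,y,¬σ)`, both `min{μ_k(y), μ_{k∓1}(φ⁻¹y)}/(2(K+1))`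
  (`stLift_balance`), and the reversal supplies the rest — no Jacobian on a finite space, no condition on the maps;
  **`stLiftLevel_not_detailedBalance`** — NOT reversible (`K ≥ 1`); **`stLiftSampler_isStationary`** /
  `stLiftSampler_isRowStochastic` — `P` is an exact sampler for every `μ_k`-stationary `M_k`, `0 ≤ t ≤ 1`.

Reading (no numerics implied): non-reversible level dynamics and learned maps compose into one exact sampler whose level
crosses a flat ladder in `K` moves, not order `K²`; by `LevelSchemeCutCeiling` / `LevelSchemeBallisticFloor` it still cannot
beat the flow across its worst cut nor `(3K−1)/4` steps.  NOT CLAIMED: any mixing-time CEILING (with the Bernoulli clock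
the NUMBER of level moves fluctuates diffusively; order `K` in total variation is not asserted); continuous spaces.  Literature grade (cell rule): KNOWN ALGORITHM (lifted
Metropolis / irreversible simulated tempering; map moves as in the cell's `SimulatedTemperingFlowSampler`), NEW TYPING
(exactness of the combination in the finite exact-weight vocabulary); nothing cited as a fact; no new bib keys.
-/

noncomputable section

open Finset Function
open Literature.Probability.MarkovChains

namespace Summit.Ventures.LatticeQCDFlow.Scaling

variable {S : Type*} [Fintype S] [DecidableEq S] {K : ℕ}

/-! ## §1 The lifted state space, the move, the within-level update -/

/-- The level laws on the lifted configuration space `S × Bool`: `μ_k(x)/2` for both directions. [ours] -/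
def stLiftLaw (μ : Fin (K + 1) → S → ℝ) : Fin (K + 1) → S × Bool → ℝ := fun k a => μ k a.1 / 2

/-- The level the walker at `k` heading `σ` (`true` = up) tries to enter (`k` itself if there is none). [ours] -/
def stLiftNext (k : Fin (K + 1)) : Bool → Fin (K + 1)
  | true => if h : (k : ℕ) + 1 < K + 1 then ⟨k + 1, h⟩ else k
  | false => if h : 0 < (k : ℕ) then ⟨k - 1, by omega⟩ else k

/-- The transport used when leaving level `k` in direction `σ`: up by `e_k`, down by the inverse of the up-map of
the level below (`e = fun _ => Equiv.refl S` is plain lifting). [ours] -/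
def stLiftMap (e : Fin (K + 1) → S ≃ S) (k : Fin (K + 1)) : Bool → S ≃ S
  | true => e k
  | false => (e (stLiftNext k false)).symm

/-- The acceptance of the advance: `min{1, μ_{k'}(φx)/μ_k(x)}` (`φ` the transport used); `0` if there is no `k'`. [ours] -/
def stLiftAcc (μ : Fin (K + 1) → S → ℝ) (e : Fin (K + 1) → S ≃ S) (p : Fin (K + 1) × (S × Bool)) : ℝ :=
  if stLiftNext p.1 p.2.2 = p.1 then 0
  else min 1 (μ (stLiftNext p.1 p.2.2) (stLiftMap e p.1 p.2.2 p.2.1) / μ p.1 p.2.1)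

/-- The advanced state: next level, transported configuration, same direction. [ours] -/
def stLiftAdv (e : Fin (K + 1) → S ≃ S) (p : Fin (K + 1) × (S × Bool)) : Fin (K + 1) × (S × Bool) :=
  (stLiftNext p.1 p.2.2, (stLiftMap e p.1 p.2.2 p.2.1, p.2.2))

/-- The reversed state: same level and configuration, opposite direction. [ours] -/
def stLiftFlip (p : Fin (K + 1) × (S × Bool)) : Fin (K + 1) × (S × Bool) := (p.1, (p.2.1, !p.2.2))

/-- THE LIFTED LEVEL MOVE: advance through the transport with probability `stLiftAcc`, else reverse direction. [ours] -/
def stLiftLevel (μ : Fin (K + 1) → S → ℝ) (e : Fin (K + 1) → S ≃ S) :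
    Matrix (Fin (K + 1) × (S × Bool)) (Fin (K + 1) × (S × Bool)) ℝ :=
  fun p q => (if q = stLiftAdv e p then stLiftAcc μ e p else 0) + (if q = stLiftFlip p then 1 - stLiftAcc μ e p else 0)

/-- The within-level update on the lifted space: move the configuration with `M_k`, keep the direction. [ours] -/
def stLiftWithin (M : Fin (K + 1) → Matrix S S ℝ) : Fin (K + 1) → Matrix (S × Bool) (S × Bool) ℝ :=
  fun k a b => if b.2 = a.2 then M k a.1 b.1 else 0

section Basic

variable {μ : Fin (K + 1) → S → ℝ} {e : Fin (K + 1) → S ≃ S} {M : Fin (K + 1) → Matrix S S ℝ}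

omit [Fintype S] [DecidableEq S] in
/-- The lifted level laws are positive. [ours] -/
theorem stLiftLaw_pos (hμ : ∀ k x, 0 < μ k x) (k : Fin (K + 1)) (a : S × Bool) : 0 < stLiftLaw μ k a := by
  unfold stLiftLaw; exact div_pos (hμ k a.1) two_pos

omit [DecidableEq S] in
/-- The lifted level laws are probability vectors. [ours] -/
theorem sum_stLiftLaw (hμ1 : ∀ k, ∑ x, μ k x = 1) (k : Fin (K + 1)) : ∑ a, stLiftLaw μ k a = 1 := by
  unfold stLiftLaw; rw [Fintype.sum_prod_type]; simp_rw [Fintype.sum_bool, add_halves]; exact hμ1 k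

omit [Fintype S] [DecidableEq S] in
/-- Where the walker goes: up by one (`σ = ↑`, `k < K`), down by one (`σ = ↓`, `k > 0`), or nowhere. [ours] -/
theorem stLiftNext_spec (k : Fin (K + 1)) (σ : Bool) :
    (σ = true ∧ (k : ℕ) < K ∧ (stLiftNext k σ : ℕ) = k + 1) ∨
    (σ = false ∧ 0 < (k : ℕ) ∧ (stLiftNext k σ : ℕ) + 1 = k) ∨
    (stLiftNext k σ = k ∧ ((σ = true ∧ (k : ℕ) = K) ∨ (σ = false ∧ (k : ℕ) = 0))) := by
  have hk := k.isLt
  cases σ with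
  | true => by_cases h : (k : ℕ) + 1 < K + 1
            · left; refine ⟨rfl, by omega, ?_⟩; simp only [stLiftNext, dif_pos h]
            · right; right; refine ⟨by simp only [stLiftNext, dif_neg h], Or.inl ⟨rfl, by omega⟩⟩
  | false => by_cases h : 0 < (k : ℕ)
             · right; left; refine ⟨rfl, h, ?_⟩; simp only [stLiftNext, dif_pos h]; omega
             · right; right; refine ⟨by simp only [stLiftNext, dif_neg h], Or.inr ⟨rfl, by omega⟩⟩

omit [Fintype S] [DecidableEq S] in
/-- `0 ≤ stLiftAcc ≤ 1` (`μ > 0`). [ours] -/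
theorem stLiftAcc_mem (hμ : ∀ k x, 0 < μ k x) (p : Fin (K + 1) × (S × Bool)) :
    0 ≤ stLiftAcc μ e p ∧ stLiftAcc μ e p ≤ 1 := by
  unfold stLiftAcc; split_ifs
  exacts [⟨le_rfl, zero_le_one⟩, ⟨le_min zero_le_one (div_pos (hμ _ _) (hμ _ _)).le, min_le_left _ _⟩]

omit [Fintype S] [DecidableEq S] in
/-- Advancing and reversing lead to different states (the direction differs). [ours] -/
theorem stLiftAdv_ne_stLiftFlip (e : Fin (K + 1) → S ≃ S) (p : Fin (K + 1) × (S × Bool)) :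
    stLiftAdv e p ≠ stLiftFlip p := fun h0 => by
  have h := congrArg (fun r : Fin (K + 1) × (S × Bool) => r.2.2) h0
  unfold stLiftAdv stLiftFlip at h; simp at h

/-- **The lifted level move is a transition matrix** (`μ > 0`). [ours] -/
theorem stLiftLevel_isRowStochastic (hμ : ∀ k x, 0 < μ k x) : IsRowStochastic (stLiftLevel μ e) := by
  refine ⟨fun p q => ?_, fun p => ?_⟩
  · unfold stLiftLevel
    obtain ⟨h0, h1⟩ := stLiftAcc_mem (e := e) hμ p
    refine add_nonneg ?_ ?_ <;> split_ifs <;> linarith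
  · unfold stLiftLevel
    rw [sum_add_distrib, sum_ite_eq' univ (stLiftAdv e p), sum_ite_eq' univ (stLiftFlip p), if_pos (mem_univ _),
      if_pos (mem_univ _)]; ring

omit [Fintype S] in
/-- Off the two targets the move has no mass. [ours] -/
theorem stLiftLevel_eq_zero {p q : Fin (K + 1) × (S × Bool)} (h1 : q ≠ stLiftAdv e p) (h2 : q ≠ stLiftFlip p) :
    stLiftLevel μ e p q = 0 := by
  unfold stLiftLevel; rw [if_neg h1, if_neg h2, add_zero]

omit [Fintype S] in
/-- **The move keeps or transports the configuration** (sector-preserving maps keep the sector). [ours] -/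
theorem stLiftLevel_snd_eq {p q : Fin (K + 1) × (S × Bool)} (h : stLiftLevel μ e p q ≠ 0) :
    q.2.1 = p.2.1 ∨ q.2.1 = stLiftMap e p.1 p.2.2 p.2.1 := by
  by_cases h1 : q = stLiftAdv e p
  · exact Or.inr (by rw [h1]; rfl)
  · by_cases h2 : q = stLiftFlip p
    exacts [Or.inl (by rw [h2]; rfl), absurd (stLiftLevel_eq_zero h1 h2) h]

omit [Fintype S] in
/-- **One level per step:** `L(p,q) ≠ 0 ⇒ q.1 ≤ p.1 + 1` (the hypothesis of `LevelSchemeBallisticFloor`). [ours] -/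
theorem stLiftLevel_rise_le_one {p q : Fin (K + 1) × (S × Bool)} (h : stLiftLevel μ e p q ≠ 0) :
    (q.1 : ℕ) ≤ p.1 + 1 := by
  by_cases h1 : q = stLiftAdv e p
  · rw [h1]; unfold stLiftAdv
    rcases stLiftNext_spec p.1 p.2.2 with ⟨-, -, e⟩ | ⟨-, -, e⟩ | ⟨e, -⟩ <;> simp only [e] <;> omega
  · by_cases h2 : q = stLiftFlip p
    exacts [by rw [h2]; unfold stLiftFlip; simp, absurd (stLiftLevel_eq_zero h1 h2) h]

omit [DecidableEq S] in
/-- The lifted within-level update is a transition matrix when every `M_k` is. [ours] -/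
theorem stLiftWithin_isRowStochastic (hM : ∀ k, IsRowStochastic (M k)) (k : Fin (K + 1)) :
    IsRowStochastic (stLiftWithin M k) := by
  refine ⟨fun a b => ?_, fun a => ?_⟩
  · unfold stLiftWithin; split_ifs; exacts [(hM k).1 _ _, le_rfl]
  · unfold stLiftWithin; rw [Fintype.sum_prod_type]; simp_rw [Fintype.sum_bool]; cases a.2 <;> simp [(hM k).2 a.1]

omit [DecidableEq S] in
/-- **`μ_k`-stationary updates give `stLiftLaw μ k`-stationary lifted updates** (no reversibility). [ours] -/
theorem stLiftWithin_isStationary (hMst : ∀ k, IsStationary (μ k) (M k)) (k : Fin (K + 1)) :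
    IsStationary (stLiftLaw μ k) (stLiftWithin M k) := by
  intro b
  unfold stLiftLaw stLiftWithin
  rw [Fintype.sum_prod_type]; simp_rw [Fintype.sum_bool]
  have h := hMst k b.1
  have e : ∀ x, μ k x / 2 * M k x b.1 = μ k x * M k x b.1 / 2 := fun x => by ring
  cases b.2 <;> simp only [Bool.true_eq_false, Bool.false_eq_true, ite_true, ite_false, mul_zero, add_zero,
    zero_add, e] <;> rw [← sum_div, h]

end Basic

/-! ## §2 Exactness: the lifted move is `π`-stationary, and not reversible -/

section Stationary

variable {μ : Fin (K + 1) → S → ℝ} {e : Fin (K + 1) → S ≃ S} {M : Fin (K + 1) → Matrix S S ℝ} {t : ℝ}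

omit [DecidableEq S] in
/-- The advance flow into `q` when it has exactly one genuine predecessor `p₀`. [ours] -/
theorem stLift_sum_adv_eq_single [DecidableEq S] (q p₀ : Fin (K + 1) × (S × Bool)) (hq : q = stLiftAdv e p₀)
    (huniq : ∀ p, q = stLiftAdv e p → stLiftNext p.1 p.2.2 ≠ p.1 → p = p₀) :
    ∑ p, stFinLaw (stLiftLaw μ) p * (if q = stLiftAdv e p then stLiftAcc μ e p else 0)
      = stFinLaw (stLiftLaw μ) p₀ * stLiftAcc μ e p₀ := by
  rw [Finset.sum_eq_single p₀ (fun p _ hp => ?_) (fun h => absurd (mem_univ _) h), if_pos hq]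
  split_ifs with h
  · by_cases hstay : stLiftNext p.1 p.2.2 = p.1
    exacts [by unfold stLiftAcc; rw [if_pos hstay, mul_zero], absurd (huniq p h hstay) hp]
  · rw [mul_zero]

omit [DecidableEq S] in
/-- The advance flow into `q` when it has no genuine predecessor. [ours] -/
theorem stLift_sum_adv_eq_zero [DecidableEq S] (q : Fin (K + 1) × (S × Bool))
    (hnone : ∀ p, q = stLiftAdv e p → stLiftNext p.1 p.2.2 = p.1) :
    ∑ p, stFinLaw (stLiftLaw μ) p * (if q = stLiftAdv e p then stLiftAcc μ e p else 0) = 0 := by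
  refine sum_eq_zero fun p _ => ?_
  split_ifs with h <;> [(unfold stLiftAcc; rw [if_pos (hnone p h), mul_zero]); rw [mul_zero]]

omit [Fintype S] [DecidableEq S] in
/-- The skew balance at one state: `b·min{1,a/b} + a·(1 − min{1,b/a}) = a` (`a, b > 0`), scaled. [ours] -/
theorem stLift_balance {a b c : ℝ} (ha : 0 < a) (hb : 0 < b) :
    b / 2 / c * min 1 (a / b) + a / 2 / c * (1 - min 1 (b / a)) = a / 2 / c := by
  have e1 : b * min 1 (a / b) = min b a := by rw [mul_min_of_nonneg _ _ hb.le, mul_one, mul_div_cancel₀ _ hb.ne']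
  have e2 : a * min 1 (b / a) = min a b := by rw [mul_min_of_nonneg _ _ ha.le, mul_one, mul_div_cancel₀ _ ha.ne']
  calc b / 2 / c * min 1 (a / b) + a / 2 / c * (1 - min 1 (b / a))
      = (b * min 1 (a / b) + a - a * min 1 (b / a)) / 2 / c := by ring
    _ = a / 2 / c := by rw [e1, e2, min_comm b a]; ring

/-- **THE LIFTED LEVEL MOVE IS EXACT:** `π = stFinLaw (stLiftLaw μ)` is stationary for `stLiftLevel μ e` (`μ > 0`) — the
advance flow into `(k,x,σ)` equals the advance flow out of `(k,x,¬σ)`, and the reversal supplies the rest. [ours] -/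
theorem stLiftLevel_isStationary (hμ : ∀ k x, 0 < μ k x) :
    IsStationary (stFinLaw (stLiftLaw μ)) (stLiftLevel μ e) := by
  rintro ⟨k, x, σ⟩
  -- split the kernel into its advance part and its reversal part; the reversal part has one term
  have hflip : ∑ p, stFinLaw (stLiftLaw μ) p * (if (k, (x, σ)) = stLiftFlip p then 1 - stLiftAcc μ e p else 0)
      = stFinLaw (stLiftLaw μ) (k, (x, !σ)) * (1 - stLiftAcc μ e (k, (x, !σ))) := by
    have e : ∀ p : Fin (K + 1) × (S × Bool), ((k, (x, σ)) = stLiftFlip p) ↔ (p = (k, (x, !σ))) := by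
      rintro ⟨l, y, τ⟩
      unfold stLiftFlip
      constructor <;> (intro h; simp only [Prod.mk.injEq] at h; obtain ⟨h1, h2, h3⟩ := h; subst h1 h2 h3; simp)
    simp_rw [e, mul_ite, mul_zero]
    rw [Finset.sum_ite_eq' univ, if_pos (mem_univ _)]
  have hsplit : ∑ p, stFinLaw (stLiftLaw μ) p * stLiftLevel μ e p (k, (x, σ))
      = ∑ p, stFinLaw (stLiftLaw μ) p * (if (k, (x, σ)) = stLiftAdv e p then stLiftAcc μ e p else 0)
        + stFinLaw (stLiftLaw μ) (k, (x, !σ)) * (1 - stLiftAcc μ e (k, (x, !σ))) := by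
    rw [← hflip, ← sum_add_distrib]
    exact sum_congr rfl fun p _ => by unfold stLiftLevel; ring
  have hlaw : ∀ (l : Fin (K + 1)) (y : S) (τ : Bool), stFinLaw (stLiftLaw μ) (l, (y, τ)) = μ l y / 2 / (K + 1) := by
    intros; rfl
  rw [hsplit, hlaw, hlaw]
  -- who advances into `(k, x, σ)`?  the state one level behind in direction `σ`, if it exists
  have hpred : ∀ p : Fin (K + 1) × (S × Bool), (k, (x, σ)) = stLiftAdv e p → stLiftNext p.1 p.2.2 ≠ p.1 →
      p.2.2 = σ ∧ stLiftMap e p.1 σ p.2.1 = x ∧ ((σ = true ∧ (p.1 : ℕ) + 1 = k) ∨ (σ = false ∧ (p.1 : ℕ) = k + 1)) := by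
    intro p h hmove
    unfold stLiftAdv at h
    simp only [Prod.mk.injEq] at h
    obtain ⟨h1, h2, h3⟩ := h
    refine ⟨h3.symm, by rw [h3, h2], ?_⟩
    rw [← h3] at hmove h1
    rcases stLiftNext_spec p.1 σ with ⟨hs, -, e'⟩ | ⟨hs, -, e'⟩ | ⟨e', -⟩
    · left; exact ⟨hs, by rw [← e', ← h1]⟩
    · right; exact ⟨hs, by have := congrArg Fin.val h1; omega⟩
    · exact absurd e' hmove
  cases σ with
  | true =>
    by_cases hk : 0 < (k : ℕ)
    · -- predecessor `(k−1, x, ↑)`; the reversal comes from `(k, x, ↓)`, which can move down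
      set km : Fin (K + 1) := ⟨k - 1, by omega⟩ with hkm
      set p₀ : Fin (K + 1) × (S × Bool) := (km, ((e km).symm x, true)) with hp₀
      have hnext : stLiftNext km true = k := by
        apply Fin.ext; simp only [stLiftNext, hkm]; rw [dif_pos (by simp; omega)]; simp only; omega
      have hq : ((k, (x, true)) : Fin (K + 1) × (S × Bool)) = stLiftAdv e p₀ := by
        rw [hp₀]; unfold stLiftAdv; simp only [stLiftMap]; rw [hnext, Equiv.apply_symm_apply]
      have hA := stLift_sum_adv_eq_single (μ := μ) _ p₀ hq (fun p h hmove => by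
        obtain ⟨hσ, hx, ⟨-, e'⟩ | ⟨hs, -⟩⟩ := hpred p h hmove
        · have hp1 : p.1 = km := Fin.ext (by rw [hkm]; simp only; omega)
          rw [hp1] at hx; simp only [stLiftMap] at hx
          rw [hp₀]; refine Prod.ext hp1 (Prod.ext ?_ hσ); simp only; rw [← hx, Equiv.symm_apply_apply]
        · simp at hs)
      have hacc₀ : stLiftAcc μ e p₀ = min 1 (μ k x / μ km ((e km).symm x)) := by
        rw [hp₀]; unfold stLiftAcc; simp only [stLiftMap]
        rw [hnext, Equiv.apply_symm_apply, if_neg (fun e' => by have := congrArg Fin.val e'; rw [hkm] at this; simp only at this; omega)]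
      have hdown : stLiftNext k false = km := by apply Fin.ext; simp only [stLiftNext, hkm]; rw [dif_pos hk]
      have hacc₁ : stLiftAcc μ e (k, (x, !true)) = min 1 (μ km ((e km).symm x) / μ k x) := by
        unfold stLiftAcc; simp only [Bool.not_true, stLiftMap]
        rw [hdown, if_neg (fun e' => by have := congrArg Fin.val e'; rw [hkm] at this; simp only at this; omega)]
      rw [hA, hp₀, hlaw, hacc₀, hacc₁]
      exact stLift_balance (hμ k x) (hμ _ _)
    · -- bottom level: nobody advances up into it; the reversal from `(0, x, ↓)` is certain
      have hA := stLift_sum_adv_eq_zero (μ := μ) ((k, (x, true)) : Fin (K + 1) × (S × Bool)) (fun p h => by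
        by_contra hmove
        obtain ⟨-, -, ⟨-, e'⟩ | ⟨hs, -⟩⟩ := hpred p h hmove
        · omega
        · simp at hs)
      have hstay : stLiftNext k false = k := by apply Fin.ext; simp only [stLiftNext]; rw [dif_neg hk]
      have hacc₁ : stLiftAcc μ e (k, (x, !true)) = 0 := by unfold stLiftAcc; simp only [Bool.not_true]; rw [if_pos hstay]
      rw [hA, hacc₁]; ring
  | false =>
    by_cases hk : (k : ℕ) < K
    · -- predecessor `(k+1, x, ↓)`; the reversal comes from `(k, x, ↑)`, which can move up
      set kp : Fin (K + 1) := ⟨k + 1, by omega⟩ with hkp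
      set p₀ : Fin (K + 1) × (S × Bool) := (kp, (e k x, false)) with hp₀
      have hnext : stLiftNext kp false = k := by
        apply Fin.ext; simp only [stLiftNext, hkp]; rw [dif_pos (by simp)]; simp
      have hq : ((k, (x, false)) : Fin (K + 1) × (S × Bool)) = stLiftAdv e p₀ := by
        rw [hp₀]; unfold stLiftAdv; simp only [stLiftMap]; rw [hnext, Equiv.symm_apply_apply]
      have hA := stLift_sum_adv_eq_single (μ := μ) _ p₀ hq (fun p h hmove => by
        obtain ⟨hσ, hx, ⟨hs, -⟩ | ⟨-, e'⟩⟩ := hpred p h hmove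
        · simp at hs
        · have hp1 : p.1 = kp := Fin.ext (by rw [hkp]; simp only; omega)
          have hnp : stLiftNext p.1 false = k := by rw [hp1, hnext]
          rw [hp1] at hx; simp only [stLiftMap] at hx; rw [hnext] at hx
          rw [hp₀]; refine Prod.ext hp1 (Prod.ext ?_ hσ); simp only; rw [← hx, Equiv.apply_symm_apply])
      have hacc₀ : stLiftAcc μ e p₀ = min 1 (μ k x / μ kp (e k x)) := by
        rw [hp₀]; unfold stLiftAcc; simp only [stLiftMap]
        rw [hnext, Equiv.symm_apply_apply, if_neg (fun e' => by have := congrArg Fin.val e'; rw [hkp] at this; simp only at this; omega)]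
      have hup : stLiftNext k true = kp := by apply Fin.ext; simp only [stLiftNext, hkp]; rw [dif_pos (by omega)]
      have hacc₁ : stLiftAcc μ e (k, (x, !false)) = min 1 (μ kp (e k x) / μ k x) := by
        unfold stLiftAcc; simp only [Bool.not_false, stLiftMap]
        rw [hup, if_neg (fun e' => by have := congrArg Fin.val e'; rw [hkp] at this; simp only at this; omega)]
      rw [hA, hp₀, hlaw, hacc₀, hacc₁]
      exact stLift_balance (hμ k x) (hμ _ _)
    · -- top level: nobody advances down into it; the reversal from `(K, x, ↑)` is certain
      have hA := stLift_sum_adv_eq_zero (μ := μ) ((k, (x, false)) : Fin (K + 1) × (S × Bool)) (fun p h => by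
        by_contra hmove
        obtain ⟨-, -, ⟨hs, -⟩ | ⟨-, e'⟩⟩ := hpred p h hmove
        · simp at hs
        · have := p.1.isLt; omega)
      have hstay : stLiftNext k true = k := by apply Fin.ext; simp only [stLiftNext]; rw [dif_neg (by omega)]
      have hacc₁ : stLiftAcc μ e (k, (x, !false)) = 0 := by unfold stLiftAcc; simp only [Bool.not_false]; rw [if_pos hstay]
      rw [hA, hacc₁]; ring

omit [Fintype S] in
/-- **THE LIFTED MOVE IS NOT REVERSIBLE** (`K ≥ 1`, `μ > 0`): `(0,x,↑) → (1,e₀x,↑)` has positive probability, the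
reversed edge none. [ours] -/
theorem stLiftLevel_not_detailedBalance [Nonempty S] (hK : 1 ≤ K) (hμ : ∀ k x, 0 < μ k x) (e : Fin (K + 1) → S ≃ S) :
    ¬ DetailedBalance (stFinLaw (stLiftLaw μ)) (stLiftLevel μ e) := by
  obtain ⟨x⟩ := (inferInstance : Nonempty S); intro hDB
  set one : Fin (K + 1) := ⟨1, by omega⟩ with hone
  have hv : (one : ℕ) = 1 := rfl
  set p : Fin (K + 1) × (S × Bool) := ((0 : Fin (K + 1)), (x, true)) with hp
  set q : Fin (K + 1) × (S × Bool) := (one, (e 0 x, true)) with hq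
  have hnext : stLiftNext (0 : Fin (K + 1)) true = one := by
    apply Fin.ext; simp only [stLiftNext]; rw [dif_pos (by simp; omega), hv]; simp
  have hadv : q = stLiftAdv e p := by rw [hq, hp]; unfold stLiftAdv; simp only [stLiftMap]; rw [hnext]
  have hacc : 0 < stLiftAcc μ e p := by
    rw [hp]; unfold stLiftAcc; simp only; rw [hnext, if_neg (fun e => by have := congrArg Fin.val e; simp [hv] at this)]
    exact lt_min one_pos (div_pos (hμ _ _) (hμ _ _))
  have hpq : 0 < stLiftLevel μ e p q := by
    unfold stLiftLevel; rw [if_pos hadv, if_neg (by rw [hadv]; exact stLiftAdv_ne_stLiftFlip e p)]; linarith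
  have hqp : stLiftLevel μ e q p = 0 := by
    refine stLiftLevel_eq_zero (fun e => ?_) (fun e => ?_)
    · have h := congrArg (fun r : Fin (K + 1) × (S × Bool) => (r.1 : ℕ)) e
      rw [hp, hq] at h; unfold stLiftAdv at h; simp only [Fin.val_zero] at h
      rcases stLiftNext_spec one true with ⟨-, -, e1⟩ | ⟨hs, -⟩ | ⟨e1, -⟩ <;> [omega; simp at hs; (rw [e1] at h; omega)]
    · rw [hp, hq] at e; unfold stLiftFlip at e; simp at e
  have h := hDB p q
  rw [hqp, mul_zero] at h; exact absurd h (mul_pos (stFinLaw_pos (stLiftLaw_pos hμ) p) hpq).ne'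

/-- The lifted sampler `t·L + (1−t)·W` is a transition matrix (`0 ≤ t ≤ 1`). [ours] -/
theorem stLiftSampler_isRowStochastic (hμ : ∀ k x, 0 < μ k x) (hM : ∀ k, IsRowStochastic (M k)) (ht0 : 0 ≤ t) (ht1 : t ≤ 1) :
    IsRowStochastic (fun p q : Fin (K + 1) × (S × Bool) =>
      t * stLiftLevel μ e p q + (1 - t) * stFinWithin (stLiftWithin M) p q) := by
  have hL := stLiftLevel_isRowStochastic (e := e) hμ
  have hW := stFinWithin_isRowStochastic (K := K) (stLiftWithin_isRowStochastic hM)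
  refine ⟨fun p q => add_nonneg (mul_nonneg ht0 (hL.1 p q)) (mul_nonneg (by linarith) (hW.1 p q)), fun p => ?_⟩
  simp only
  rw [sum_add_distrib, ← mul_sum, ← mul_sum, hL.2 p, hW.2 p]; ring

/-- **THE LIFTED SIMULATED-TEMPERING SAMPLER IS EXACT:** `π` is stationary for
`t·L + (1−t)·stFinWithin (stLiftWithin M)` whenever every `μ_k` is stationary for `M_k` — no reversibility anywhere.
[ours] -/
theorem stLiftSampler_isStationary (hμ : ∀ k x, 0 < μ k x) (hMst : ∀ k, IsStationary (μ k) (M k)) (t : ℝ) :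
    IsStationary (stFinLaw (stLiftLaw μ)) (fun p q : Fin (K + 1) × (S × Bool) =>
      t * stLiftLevel μ e p q + (1 - t) * stFinWithin (stLiftWithin M) p q) := by
  have hLst := stLiftLevel_isStationary (e := e) hμ
  have hWst : IsStationary (stFinLaw (stLiftLaw μ)) (stFinWithin (stLiftWithin M)) := by
    intro q
    rw [Fintype.sum_prod_type, Finset.sum_eq_single q.1 (fun k _ hk => ?_) (fun h => absurd (mem_univ _) h)]
    · have h := stLiftWithin_isStationary hMst q.1 q.2
      calc ∑ a, stFinLaw (stLiftLaw μ) (q.1, a) * stFinWithin (stLiftWithin M) (q.1, a) q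
          = ∑ a, stLiftLaw μ q.1 a * stLiftWithin M q.1 a q.2 / (K + 1) := by
            refine sum_congr rfl fun a _ => ?_
            rw [stFinWithin_apply, if_pos rfl]; unfold stFinLaw; ring
        _ = stFinLaw (stLiftLaw μ) q := by rw [← sum_div, h]; rfl
    · refine sum_eq_zero fun a _ => ?_
      rw [stFinWithin_apply, if_neg (fun h => hk h.symm), mul_zero]
  intro q
  calc ∑ p, stFinLaw (stLiftLaw μ) p * (t * stLiftLevel μ e p q + (1 - t) * stFinWithin (stLiftWithin M) p q)
      = t * ∑ p, stFinLaw (stLiftLaw μ) p * stLiftLevel μ e p q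
        + (1 - t) * ∑ p, stFinLaw (stLiftLaw μ) p * stFinWithin (stLiftWithin M) p q := by
        rw [mul_sum, mul_sum, ← sum_add_distrib]; exact sum_congr rfl fun p _ => by ring
    _ = stFinLaw (stLiftLaw μ) q := by rw [hLst q, hWst q]; ring

end Stationary

end Summit.Ventures.LatticeQCDFlow.Scaling

end
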